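import Summits.FinalStateConjecture.FinalStateConjecture.Theorems.EIHFluxBalanceInertialRecessionStubHigherOrderComp
import Summits.FinalStateConjecture.FinalStateConjecture.Theorems.EIHFluxBalanceInertialRecessionStubSlaving12JetCalculus

/-!
# Route EIHFluxBalance — `InertialRecession` (E′), line `SketchCleanExcision`, skeleton r13,
# stub `stub_higherOrderSlaving` (EF): the `3`-jet of a modulated field at a slice point

Helper file for the crux `stmt-FinalStateConjecture-17403`
(`Summit.FinalStateConjecture.FinalStateConjecture.Theses.EIHFluxBalance.InertialRecession`, E′),
registered stub `stub_higherOrderSlaving`.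

The frozen ansatz is `g₀(z) = Φ(z⁰, z)` for the two-variable field
`Φ(s, z) = η + Σⱼ (painted summand with moduli frozen at lab time s)(z)`. This file expresses the
`3`-jet of such a field `g(z) = Φ(π z, z)` (`π = dx⁰`) at a point `x` of the slice `{π = t}`
through the frozen field `G₀ = Φ(t, ·)` and the VARIATION FIELDS `P₁ = ∂ₛΦ(t, ·)`,
`P₂ = ∂ₛ²Φ(t, ·)`, `P₃ = ∂ₛ³Φ(t, ·)` (`higherOrder_sliceJets`):

  `Dg = DG₀ + π ⊗ P₁`, `D²g = D²G₀ + π ⊙ DP₁ + π ⊗ π ⊗ P₂`,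
  `D³g = D³G₀ + π ⊙ D²P₁ + (π ⊗ π) ⊙ DP₂ + π ⊗ π ⊗ π ⊗ P₃`

(chain rule for `Φ ∘ (π, id)` and the symmetry of second and third derivatives), together with
the identification of `P_k(z)` with the iterated `s`-derivatives of `s ↦ Φ(s, z)`
(`higherOrder_sliceVariation_eq_iteratedDeriv`) and the smoothness of `G₀`, `P_k` on the slice
domain (`higherOrder_contDiffOn_slice`).

Pure calculus; no definitions, no named facts, no `sorry`.
-/

set_option linter.dupNamespace false
set_option maxSynthPendingDepth 3

noncomputable section

namespace Summit.FinalStateConjecture.FinalStateConjecture.Theorems.SublinearIsFree.Slaving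

open scoped Topology ContDiff
open Filter Set Function Literature.Geometry.Lorentzian.MetricCoord

section SliceJets

variable {E F : Type*} [NormedAddCommGroup E] [NormedSpace ℝ E] [NormedAddCommGroup F]
  [NormedSpace ℝ F]

omit [NormedSpace ℝ E] in
/-- The slice domain `{z | (t, z) ∈ U}` of an open set is open. [folklore] -/
theorem higherOrder_isOpen_slice {U : Set (ℝ × E)} (hU : IsOpen U) (t : ℝ) :
    IsOpen {z : E | ((t, z) : ℝ × E) ∈ U} :=
  hU.preimage (Continuous.prodMk_right t)

/-- The graph domain `{z | (π z, z) ∈ U}` of an open set is open. [folklore] -/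
theorem higherOrder_isOpen_graph {U : Set (ℝ × E)} (hU : IsOpen U) (π : E →L[ℝ] ℝ) :
    IsOpen {z : E | ((π z, z) : ℝ × E) ∈ U} :=
  hU.preimage (π.continuous.prodMk continuous_id)

/-- **Smoothness of the frozen field and of the variation fields on the slice domain.**
[folklore] -/
theorem higherOrder_contDiffOn_slice {Φ : ℝ × E → F} {U : Set (ℝ × E)} (hU : IsOpen U)
    (hΦ : ContDiffOn ℝ ∞ Φ U) (t : ℝ) (π : E →L[ℝ] ℝ) :
    ContDiffOn ℝ ∞ (fun z : E ↦ Φ (t, z)) {z : E | ((t, z) : ℝ × E) ∈ U} ∧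
    ContDiffOn ℝ ∞ (fun z : E ↦ fderiv ℝ Φ (t, z) ((1 : ℝ), (0 : E)))
      {z : E | ((t, z) : ℝ × E) ∈ U} ∧
    ContDiffOn ℝ ∞ (fun z : E ↦ fderiv ℝ (fderiv ℝ Φ) (t, z) ((1 : ℝ), (0 : E)) ((1 : ℝ), (0 : E)))
      {z : E | ((t, z) : ℝ × E) ∈ U} ∧
    ContDiffOn ℝ ∞ (fun z : E ↦ fderiv ℝ (fderiv ℝ (fderiv ℝ Φ)) (t, z) ((1 : ℝ), (0 : E))
      ((1 : ℝ), (0 : E)) ((1 : ℝ), (0 : E))) {z : E | ((t, z) : ℝ × E) ∈ U} ∧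
    ContDiffOn ℝ ∞ (fun z : E ↦ Φ (π z, z)) {z : E | ((π z, z) : ℝ × E) ∈ U} := by
  have hΦ₁ : ContDiffOn ℝ ∞ (fderiv ℝ Φ) U := hΦ.fderiv_of_isOpen hU (by simp)
  have hΦ₂ : ContDiffOn ℝ ∞ (fderiv ℝ (fderiv ℝ Φ)) U := hΦ₁.fderiv_of_isOpen hU (by simp)
  have hΦ₃ : ContDiffOn ℝ ∞ (fderiv ℝ (fderiv ℝ (fderiv ℝ Φ))) U := hΦ₂.fderiv_of_isOpen hU (by simp)
  have hJ₀ : ContDiff ℝ ∞ (fun z : E ↦ ((t, z) : ℝ × E)) := contDiff_prodMk_right t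
  have hmaps : MapsTo (fun z : E ↦ ((t, z) : ℝ × E)) {z : E | ((t, z) : ℝ × E) ∈ U} U :=
    fun z hz ↦ hz
  refine ⟨hΦ.comp hJ₀.contDiffOn hmaps, ?_, ?_, ?_, ?_⟩
  · exact (hΦ₁.comp hJ₀.contDiffOn hmaps).clm_apply contDiffOn_const
  · exact ((hΦ₂.comp hJ₀.contDiffOn hmaps).clm_apply contDiffOn_const).clm_apply contDiffOn_const
  · exact (((hΦ₃.comp hJ₀.contDiffOn hmaps).clm_apply contDiffOn_const).clm_apply
      contDiffOn_const).clm_apply contDiffOn_const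
  · exact hΦ.comp (π.contDiff.prodMk contDiff_id).contDiffOn fun z hz ↦ hz

/-- **The variation fields are the iterated `s`-derivatives** of `s ↦ Φ(s, z)` at `s = t`.
[folklore] -/
theorem higherOrder_sliceVariation_eq_iteratedDeriv {Φ : ℝ × E → F} {U : Set (ℝ × E)}
    (hU : IsOpen U) (hΦ : ContDiffOn ℝ ∞ Φ U) {t : ℝ} {z : E} (hz : ((t, z) : ℝ × E) ∈ U) :
    deriv (fun s : ℝ ↦ Φ (s, z)) t = fderiv ℝ Φ (t, z) ((1 : ℝ), (0 : E)) ∧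
    iteratedDeriv 2 (fun s : ℝ ↦ Φ (s, z)) t =
      fderiv ℝ (fderiv ℝ Φ) (t, z) ((1 : ℝ), (0 : E)) ((1 : ℝ), (0 : E)) ∧
    iteratedDeriv 3 (fun s : ℝ ↦ Φ (s, z)) t =
      fderiv ℝ (fderiv ℝ (fderiv ℝ Φ)) (t, z) ((1 : ℝ), (0 : E)) ((1 : ℝ), (0 : E))
        ((1 : ℝ), (0 : E)) := by
  -- the path `s ↦ (s, z)` is smooth with derivative `(1, 0)` and vanishing higher derivatives
  set γ : ℝ → ℝ × E := fun s ↦ (s, z) with hγ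
  have hγs : ContDiff ℝ ∞ γ := contDiff_prodMk_left z
  have hd : ∀ s, HasDerivAt γ ((1 : ℝ), (0 : E)) s := fun s ↦
    (hasDerivAt_id s).prodMk (hasDerivAt_const s z)
  have hd1 : deriv γ = fun _ ↦ ((1 : ℝ), (0 : E)) := funext fun s ↦ (hd s).deriv
  have hd2 : iteratedDeriv 2 γ t = 0 := by
    rw [iteratedDeriv_succ, iteratedDeriv_one, hd1, deriv_const]
  have hd3 : iteratedDeriv 3 γ t = 0 := by
    rw [iteratedDeriv_succ, iteratedDeriv_succ, iteratedDeriv_one, hd1]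
    simp
  have hcomp : (fun s : ℝ ↦ Φ (s, z)) = Φ ∘ γ := rfl
  have hγt : γ t = (t, z) := rfl
  obtain ⟨e1, e2, e3⟩ := higherOrder_deriv_comp₃ hU hΦ hγs (t := t) hz
  rw [hcomp, e1, e2, e3, hd1, hd2, hd3, hγt]
  simp

/-- Expansion of the graph differential: `(π v, v) = π(v) • (1, 0) + (0, v)`. [folklore] -/
theorem higherOrder_graph_dir (π : E →L[ℝ] ℝ) (v : E) :
    ((π v, v) : ℝ × E) = π v • ((1 : ℝ), (0 : E)) + ((0 : ℝ), v) := by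
  ext <;> simp

set_option maxHeartbeats 800000 in
/-- **The `3`-jet of `g(z) = Φ(π z, z)` at a slice point** `x` (`π x = t`) through the frozen field
`G₀ = Φ(t, ·)` and the variation fields `P_k = ∂ₛᵏΦ(t, ·)`:
`Dg(x) v = DG₀(x) v + π(v) P₁(x)`,
`D²g(x)(v,w) = D²G₀(x)(v,w) + π(v) DP₁(x) w + π(w) DP₁(x) v + π(v)π(w) P₂(x)`,
`D³g(x)(y,v,w) = D³G₀(x)(y,v,w) + [π(v) D²P₁(x)(y,w) + π(w) D²P₁(x)(y,v) + π(y) D²P₁(x)(v,w)]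
  + [π(v)π(w) DP₂(x) y + π(y)π(w) DP₂(x) v + π(y)π(v) DP₂(x) w] + π(y)π(v)π(w) P₃(x)`
(chain rule, symmetry of `D²Φ` and `D³Φ`). [folklore] -/
theorem higherOrder_sliceJets {Φ : ℝ × E → F} {U : Set (ℝ × E)} (hU : IsOpen U)
    (hΦ : ContDiffOn ℝ ∞ Φ U) (π : E →L[ℝ] ℝ) {t : ℝ} {x : E} (hx : ((t, x) : ℝ × E) ∈ U)
    (hπ : π x = t) :
    (fun z : E ↦ Φ (π z, z)) x = Φ (t, x) ∧
    (∀ v, fderiv ℝ (fun z : E ↦ Φ (π z, z)) x v =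
      fderiv ℝ (fun z : E ↦ Φ (t, z)) x v + π v • fderiv ℝ Φ (t, x) ((1 : ℝ), (0 : E))) ∧
    (∀ v w, fderiv ℝ (fderiv ℝ (fun z : E ↦ Φ (π z, z))) x v w =
      fderiv ℝ (fderiv ℝ (fun z : E ↦ Φ (t, z))) x v w +
      π v • fderiv ℝ (fun z : E ↦ fderiv ℝ Φ (t, z) ((1 : ℝ), (0 : E))) x w +
      π w • fderiv ℝ (fun z : E ↦ fderiv ℝ Φ (t, z) ((1 : ℝ), (0 : E))) x v +
      (π v * π w) • fderiv ℝ (fderiv ℝ Φ) (t, x) ((1 : ℝ), (0 : E)) ((1 : ℝ), (0 : E))) ∧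
    (∀ y v w, fderiv ℝ (fderiv ℝ (fderiv ℝ (fun z : E ↦ Φ (π z, z)))) x y v w =
      fderiv ℝ (fderiv ℝ (fderiv ℝ (fun z : E ↦ Φ (t, z)))) x y v w +
      (π v • fderiv ℝ (fderiv ℝ (fun z : E ↦ fderiv ℝ Φ (t, z) ((1 : ℝ), (0 : E)))) x y w +
        π w • fderiv ℝ (fderiv ℝ (fun z : E ↦ fderiv ℝ Φ (t, z) ((1 : ℝ), (0 : E)))) x y v +
        π y • fderiv ℝ (fderiv ℝ (fun z : E ↦ fderiv ℝ Φ (t, z) ((1 : ℝ), (0 : E)))) x v w) +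
      ((π v * π w) • fderiv ℝ (fun z : E ↦ fderiv ℝ (fderiv ℝ Φ) (t, z) ((1 : ℝ), (0 : E))
          ((1 : ℝ), (0 : E))) x y +
        (π y * π w) • fderiv ℝ (fun z : E ↦ fderiv ℝ (fderiv ℝ Φ) (t, z) ((1 : ℝ), (0 : E))
          ((1 : ℝ), (0 : E))) x v +
        (π y * π v) • fderiv ℝ (fun z : E ↦ fderiv ℝ (fderiv ℝ Φ) (t, z) ((1 : ℝ), (0 : E))
          ((1 : ℝ), (0 : E))) x w) +
      (π y * π v * π w) • fderiv ℝ (fderiv ℝ (fderiv ℝ Φ)) (t, x) ((1 : ℝ), (0 : E))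
        ((1 : ℝ), (0 : E)) ((1 : ℝ), (0 : E))) := by
  -- notation
  set e : ℝ × E := ((1 : ℝ), (0 : E)) with he
  set ι : E →L[ℝ] ℝ × E := ContinuousLinearMap.inr ℝ ℝ E with hι
  set J : E →L[ℝ] ℝ × E := π.prod (ContinuousLinearMap.id ℝ E) with hJ
  set p : ℝ × E := (t, x) with hp
  set Φ₁ := fderiv ℝ Φ with hΦ₁
  set Φ₂ := fderiv ℝ Φ₁ with hΦ₂
  set Φ₃ := fderiv ℝ Φ₂ with hΦ₃
  have hΦ₁c : ContDiffOn ℝ ∞ Φ₁ U := hΦ.fderiv_of_isOpen hU (by simp)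
  have hΦ₂c : ContDiffOn ℝ ∞ Φ₂ U := hΦ₁c.fderiv_of_isOpen hU (by simp)
  have hdΦ : ∀ q ∈ U, HasFDerivAt Φ (Φ₁ q) q := fun q hq ↦
    ((hΦ.differentiableOn (by simp)).differentiableAt (hU.mem_nhds hq)).hasFDerivAt
  have hdΦ₁ : ∀ q ∈ U, DifferentiableAt ℝ Φ₁ q := fun q hq ↦
    (hΦ₁c.differentiableOn (by simp)).differentiableAt (hU.mem_nhds hq)
  have hdΦ₂ : ∀ q ∈ U, DifferentiableAt ℝ Φ₂ q := fun q hq ↦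
    (hΦ₂c.differentiableOn (by simp)).differentiableAt (hU.mem_nhds hq)
  have hJz : ∀ z : E, J z = (π z, z) := fun z ↦ rfl
  have hJx : J x = p := by rw [hJz, hπ]
  have hJ0 : (0 : ℝ × E) + J x = p := by rw [zero_add, hJx]
  have hι0 : ∀ z : E, ((t, (0 : E)) : ℝ × E) + ι z = (t, z) := fun z ↦ by simp [hι]
  have hιx : ((t, (0 : E)) : ℝ × E) + ι x = p := hι0 x
  have hJv : ∀ v : E, J v = π v • e + ι v := fun v ↦ by
    simp only [hJ, he, hι, ContinuousLinearMap.prod_apply, ContinuousLinearMap.coe_id', id_eq,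
      ContinuousLinearMap.inr_apply]
    exact higherOrder_graph_dir π v
  -- symmetries of the second and third derivatives at `p`
  have hS2 : ∀ a b, Φ₂ p a b = Φ₂ p b a := fun a b ↦
    ((hΦ.contDiffAt (hU.mem_nhds hx)).isSymmSndFDerivAt two_le_infty).eq a b
  have hS3a : ∀ a b c, Φ₃ p a b c = Φ₃ p b a c := fun a b c ↦ by
    have h := ((hΦ₁c.contDiffAt (hU.mem_nhds hx)).isSymmSndFDerivAt two_le_infty).eq a b
    rw [hΦ₃, hΦ₂, h]
  have hS3b : ∀ a b c, Φ₃ p a b c = Φ₃ p a c b := by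
    intro a b c
    have h1 : Φ₃ p a b c = fderiv ℝ (fun q ↦ Φ₂ q b c) p a := by
      rw [hΦ₃, fderiv_clm_apply_const (differentiableAt_clm_apply_const (hdΦ₂ p hx) b) c a,
        fderiv_clm_apply_const (hdΦ₂ p hx) b a]
    have h2 : Φ₃ p a c b = fderiv ℝ (fun q ↦ Φ₂ q c b) p a := by
      rw [hΦ₃, fderiv_clm_apply_const (differentiableAt_clm_apply_const (hdΦ₂ p hx) c) b a,
        fderiv_clm_apply_const (hdΦ₂ p hx) c a]
    have heq : (fun q ↦ Φ₂ q b c) =ᶠ[𝓝 p] fun q ↦ Φ₂ q c b := by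
      filter_upwards [hU.mem_nhds hx] with q hq
      exact ((hΦ.contDiffAt (hU.mem_nhds hq)).isSymmSndFDerivAt two_le_infty).eq b c
    rw [h1, h2, heq.fderiv_eq]
  -- the graph field `g = Φ ∘ J` and the frozen field `G₀ = Φ ∘ (t, ·)`: first derivatives
  set g : E → F := fun z ↦ Φ (π z, z) with hg
  set G₀ : E → F := fun z ↦ Φ (t, z) with hG₀
  set Ug : Set E := {z : E | ((π z, z) : ℝ × E) ∈ U} with hUg
  set U₀ : Set E := {z : E | ((t, z) : ℝ × E) ∈ U} with hU₀
  have hUgo : IsOpen Ug := higherOrder_isOpen_graph hU π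
  have hU₀o : IsOpen U₀ := higherOrder_isOpen_slice hU t
  have hxg : x ∈ Ug := by show ((π x, x) : ℝ × E) ∈ U; rwa [hπ]
  have hx₀ : x ∈ U₀ := hx
  have hg1 : ∀ z ∈ Ug, HasFDerivAt g ((Φ₁ (J z)).comp J) z := fun z hz ↦ by
    have hz' : J z ∈ U := by rw [hJz]; exact hz
    have h := (hdΦ (J z) hz').comp z J.hasFDerivAt
    have heq : g = Φ ∘ J := by funext w; rw [Function.comp_apply, hJz]
    rw [heq]; exact h
  have hG1 : ∀ z ∈ U₀, HasFDerivAt G₀ ((Φ₁ ((t, (0 : E)) + ι z)).comp ι) z := fun z hz ↦ by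
    have hz' : ((t, (0 : E)) : ℝ × E) + ι z ∈ U := by rw [hι0]; exact hz
    have h := (hdΦ _ hz').comp z ((ι.hasFDerivAt).const_add ((t, (0 : E)) : ℝ × E))
    have heq : G₀ = Φ ∘ fun z ↦ ((t, (0 : E)) : ℝ × E) + ι z := by
      funext w; simp [hG₀, hι]
    rw [heq]; exact h
  have hg1' : ∀ z ∈ Ug, ∀ w, fderiv ℝ g z w = Φ₁ ((0 : ℝ × E) + J z) (J w) := fun z hz w ↦ by
    rw [(hg1 z hz).fderiv, zero_add]; rfl
  have hG1' : ∀ z ∈ U₀, ∀ w, fderiv ℝ G₀ z w = Φ₁ ((t, (0 : E)) + ι z) (ι w) := fun z hz w ↦ by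
    rw [(hG1 z hz).fderiv]; rfl
  -- second derivatives on the domains
  have hg2 : ∀ z ∈ Ug, ∀ v w, fderiv ℝ (fderiv ℝ g) z v w = Φ₂ ((0 : ℝ × E) + J z) (J v) (J w) := by
    intro z hz v w
    have hdg : DifferentiableAt ℝ (fderiv ℝ g) z :=
      (((higherOrder_contDiffOn_slice hU hΦ t π).2.2.2.2.fderiv_of_isOpen (m := ∞) hUgo (by simp)).differentiableOn
        (by simp)).differentiableAt (hUgo.mem_nhds hz)
    rw [← fderiv_clm_apply_const hdg w v]
    have heq : (fun z' ↦ fderiv ℝ g z' w) =ᶠ[𝓝 z] fun z' ↦ Φ₁ ((0 : ℝ × E) + J z') (J w) := by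
      filter_upwards [hUgo.mem_nhds hz] with z' hz' using hg1' z' hz' w
    rw [heq.fderiv_eq]
    have hz0 : (0 : ℝ × E) + J z ∈ U := by rw [zero_add, hJz]; exact hz
    exact (higherOrder_fderiv_affine hU hΦ 0 J hz0 (J w) e e).1 v
  have hG2 : ∀ z ∈ U₀, ∀ v w, fderiv ℝ (fderiv ℝ G₀) z v w =
      Φ₂ ((t, (0 : E)) + ι z) (ι v) (ι w) := by
    intro z hz v w
    have hdg : DifferentiableAt ℝ (fderiv ℝ G₀) z :=
      (((higherOrder_contDiffOn_slice hU hΦ t π).1.fderiv_of_isOpen (m := ∞) hU₀o (by simp)).differentiableOn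
        (by simp)).differentiableAt (hU₀o.mem_nhds hz)
    rw [← fderiv_clm_apply_const hdg w v]
    have heq : (fun z' ↦ fderiv ℝ G₀ z' w) =ᶠ[𝓝 z] fun z' ↦ Φ₁ ((t, (0 : E)) + ι z') (ι w) := by
      filter_upwards [hU₀o.mem_nhds hz] with z' hz' using hG1' z' hz' w
    rw [heq.fderiv_eq]
    have hz0 : ((t, (0 : E)) : ℝ × E) + ι z ∈ U := by rw [hι0]; exact hz
    exact (higherOrder_fderiv_affine hU hΦ _ ι hz0 (ι w) e e).1 v
  -- third derivatives at `x`
  have hg3 : ∀ y v w, fderiv ℝ (fderiv ℝ (fderiv ℝ g)) x y v w = Φ₃ p (J y) (J v) (J w) := by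
    intro y v w
    have hc2 : ContDiffOn ℝ ∞ (fderiv ℝ (fderiv ℝ g)) Ug :=
      ((higherOrder_contDiffOn_slice hU hΦ t π).2.2.2.2.fderiv_of_isOpen (m := ∞) hUgo
        (by simp)).fderiv_of_isOpen (m := ∞) hUgo (by simp)
    have hdg : DifferentiableAt ℝ (fderiv ℝ (fderiv ℝ g)) x :=
      (hc2.differentiableOn (by simp)).differentiableAt (hUgo.mem_nhds hxg)
    rw [← fderiv_clm_apply_const hdg v y,
      ← fderiv_clm_apply_const (differentiableAt_clm_apply_const hdg v) w y]
    have heq : (fun z' ↦ fderiv ℝ (fderiv ℝ g) z' v w) =ᶠ[𝓝 x]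
        fun z' ↦ Φ₂ ((0 : ℝ × E) + J z') (J v) (J w) := by
      filter_upwards [hUgo.mem_nhds hxg] with z' hz' using hg2 z' hz' v w
    have hx'' : (0 : ℝ × E) + J x ∈ U := by rw [hJ0]; exact hx
    rw [heq.fderiv_eq, (higherOrder_fderiv_affine hU hΦ 0 J hx'' e (J v) (J w)).2.1 y, hJ0]
  have hG3 : ∀ y v w, fderiv ℝ (fderiv ℝ (fderiv ℝ G₀)) x y v w = Φ₃ p (ι y) (ι v) (ι w) := by
    intro y v w
    have hc2 : ContDiffOn ℝ ∞ (fderiv ℝ (fderiv ℝ G₀)) U₀ :=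
      ((higherOrder_contDiffOn_slice hU hΦ t π).1.fderiv_of_isOpen (m := ∞) hU₀o
        (by simp)).fderiv_of_isOpen (m := ∞) hU₀o (by simp)
    have hdg : DifferentiableAt ℝ (fderiv ℝ (fderiv ℝ G₀)) x :=
      (hc2.differentiableOn (by simp)).differentiableAt (hU₀o.mem_nhds hx₀)
    rw [← fderiv_clm_apply_const hdg v y,
      ← fderiv_clm_apply_const (differentiableAt_clm_apply_const hdg v) w y]
    have heq : (fun z' ↦ fderiv ℝ (fderiv ℝ G₀) z' v w) =ᶠ[𝓝 x]
        fun z' ↦ Φ₂ ((t, (0 : E)) + ι z') (ι v) (ι w) := by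
      filter_upwards [hU₀o.mem_nhds hx₀] with z' hz' using hG2 z' hz' v w
    have hx' : ((t, (0 : E)) : ℝ × E) + ι x ∈ U := by rw [hιx]; exact hx
    rw [heq.fderiv_eq, (higherOrder_fderiv_affine hU hΦ _ ι hx' e (ι v) (ι w)).2.1 y, hιx]
  -- the variation fields `P₁`, `P₂` and their derivatives at `x`
  set P₁ : E → F := fun z ↦ Φ₁ (t, z) e with hP₁
  set P₂ : E → F := fun z ↦ Φ₂ (t, z) e e with hP₂
  have hP₁eq : P₁ = fun z ↦ Φ₁ ((t, (0 : E)) + ι z) e := by funext z; rw [hι0]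
  have hP₂eq : P₂ = fun z ↦ Φ₂ ((t, (0 : E)) + ι z) e e := by funext z; rw [hι0]
  have hx' : ((t, (0 : E)) : ℝ × E) + ι x ∈ U := by rw [hιx]; exact hx
  have hA := higherOrder_fderiv_affine hU hΦ ((t, (0 : E)) : ℝ × E) ι hx' e e e
  have hP₁d : ∀ v, fderiv ℝ P₁ x v = Φ₂ p (ι v) e := fun v ↦ by rw [hP₁eq, hA.1 v, hιx]
  have hP₁dd : ∀ v w, fderiv ℝ (fderiv ℝ P₁) x v w = Φ₃ p (ι v) (ι w) e := fun v w ↦ by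
    rw [hP₁eq, hA.2.2 v w, hιx]
  have hP₂d : ∀ v, fderiv ℝ P₂ x v = Φ₃ p (ι v) e e := fun v ↦ by rw [hP₂eq, hA.2.1 v, hιx]
  -- assembly
  refine ⟨?_, fun v ↦ ?_, fun v w ↦ ?_, fun y v w ↦ ?_⟩
  · show Φ (π x, x) = Φ (t, x); rw [hπ]
  · show fderiv ℝ g x v = fderiv ℝ G₀ x v + π v • Φ₁ p e
    rw [hg1' x hxg, hG1' x hx₀, hJ0, hιx, hJv, map_add, map_smul, add_comm]
  · show fderiv ℝ (fderiv ℝ g) x v w =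
      fderiv ℝ (fderiv ℝ G₀) x v w + π v • fderiv ℝ P₁ x w + π w • fderiv ℝ P₁ x v + (π v * π w) • P₂ x
    rw [hg2 x hxg, hG2 x hx₀, hJ0, hιx, hP₁d, hP₁d, hJv, hJv]
    have hP₂x : P₂ x = Φ₂ p e e := rfl
    rw [hP₂x]
    simp only [map_add, map_smul, _root_.add_apply, _root_.smul_apply]
    have c1 : Φ₂ p e (ι w) = Φ₂ p (ι w) e := hS2 _ _
    simp only [c1, smul_add, smul_smul]
    module
  · show fderiv ℝ (fderiv ℝ (fderiv ℝ g)) x y v w =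
      fderiv ℝ (fderiv ℝ (fderiv ℝ G₀)) x y v w +
      (π v • fderiv ℝ (fderiv ℝ P₁) x y w + π w • fderiv ℝ (fderiv ℝ P₁) x y v +
        π y • fderiv ℝ (fderiv ℝ P₁) x v w) +
      ((π v * π w) • fderiv ℝ P₂ x y + (π y * π w) • fderiv ℝ P₂ x v + (π y * π v) • fderiv ℝ P₂ x w) +
      (π y * π v * π w) • Φ₃ p e e e
    rw [hg3, hG3, hP₁dd, hP₁dd, hP₁dd, hP₂d, hP₂d, hP₂d, hJv, hJv, hJv]
    simp only [map_add, map_smul, _root_.add_apply, _root_.smul_apply]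
    -- bring all third derivatives to the normal forms used on the right
    have c2 : Φ₃ p e e (ι w) = Φ₃ p (ι w) e e := by rw [hS3b, hS3a]
    have c4 : Φ₃ p e (ι v) e = Φ₃ p (ι v) e e := hS3a _ _ _
    have c6 : Φ₃ p e (ι v) (ι w) = Φ₃ p (ι v) (ι w) e := by rw [hS3a, hS3b]
    have c7 : Φ₃ p (ι y) e (ι w) = Φ₃ p (ι y) (ι w) e := hS3b _ _ _
    simp only [c2, c4, c6, c7, smul_add, smul_smul]
    module


/-- **Registered one-line carrier form** (`higherOrder_sliceJets_EF`) of `higherOrder_sliceJets`. [folklore] -/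
theorem higherOrder_sliceJets_EF : ∀ {E F : Type} [NormedAddCommGroup E] [NormedSpace ℝ E] [NormedAddCommGroup F] [NormedSpace ℝ F] {Φ : ℝ × E → F} {U : Set (ℝ × E)}, IsOpen U → ContDiffOn ℝ ((⊤ : ℕ∞) : WithTop ℕ∞) Φ U → ∀ (π : E →L[ℝ] ℝ) {t : ℝ} {x : E}, ((t, x) : ℝ × E) ∈ U → π x = t → (fun z : E ↦ Φ (π z, z)) x = Φ (t, x) ∧ (∀ v, fderiv ℝ (fun z : E ↦ Φ (π z, z)) x v = fderiv ℝ (fun z : E ↦ Φ (t, z)) x v + π v • fderiv ℝ Φ (t, x) ((1 : ℝ), (0 : E))) ∧ (∀ v w, fderiv ℝ (fderiv ℝ (fun z : E ↦ Φ (π z, z))) x v w = fderiv ℝ (fderiv ℝ (fun z : E ↦ Φ (t, z))) x v w + π v • fderiv ℝ (fun z : E ↦ fderiv ℝ Φ (t, z) ((1 : ℝ), (0 : E))) x w + π w • fderiv ℝ (fun z : E ↦ fderiv ℝ Φ (t, z) ((1 : ℝ), (0 : E))) x v + (π v * π w) • fderiv ℝ (fderiv ℝ Φ) (t, x) ((1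 : ℝ), (0 : E)) ((1 : ℝ), (0 : E))) ∧ (∀ y v w, fderiv ℝ (fderiv ℝ (fderiv ℝ (fun z : E ↦ Φ (π z, z)))) x y v w = fderiv ℝ (fderiv ℝ (fderiv ℝ (fun z : E ↦ Φ (t, z)))) x y v w + (π v • fderiv ℝ (fderiv ℝ (fun z : E ↦ fderiv ℝ Φ (t, z) ((1 : ℝ), (0 : E)))) x y w + π w • fderiv ℝ (fderiv ℝ (fun z : E ↦ fderiv ℝ Φ (t, z) ((1 : ℝ), (0 : E)))) x y v + π y • fderiv ℝ (fderiv ℝ (fun z : E ↦ fderiv ℝ Φ (t, z) ((1 : ℝ), (0 : E)))) x v w) + ((π v * π w) • fderiv ℝ (fun z : E ↦ fderiv ℝ (fderiv ℝ Φ) (t, z) ((1 : ℝ), (0 : E)) ((1 : ℝ), (0 : E))) x y + (π y * π w) • fderiv ℝ (fun z : E ↦ fderiv ℝ (fderiv ℝ Φ) (t, z) ((1 : ℝ), (0 : E)) ((1 : ℝ), (0 : E))) x v + (π y * π v) • fderiv ℝ (fun z : E ↦ fderiv ℝ (fderiv ℝ Φ) (t, z) ((1 : ℝ), (0 : E)) ((1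 : ℝ), (0 : E))) x w) + (π y * π v * π w) • fderiv ℝ (fderiv ℝ (fderiv ℝ Φ)) (t, x) ((1 : ℝ), (0 : E)) ((1 : ℝ), (0 : E)) ((1 : ℝ), (0 : E))) :=
  fun hU hΦ π _ _ hx hπ ↦ higherOrder_sliceJets hU hΦ π hx hπ

end SliceJets

end Summit.FinalStateConjecture.FinalStateConjecture.Theorems.SublinearIsFree.Slaving

end
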